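import Mathlib
import Summits.KontsevichZagierPeriods.KontsevichZagierPeriods.Theorems.SoloInformedLengthFaces
import HarnessLib
import HarnessLib.Audit

/-!
# SoloInformed — length faces with arctangent blocks: `ζ(3)/(π² log 2)`, `ζ(5)/(π² ζ(3))`, `ζ(3)²/π⁶`

`SoloInformedLengthFaces` recorded four faces of the Kontsevich–Zagier conjecture which the SIGN
invariant of `SoloInformedParityFaces` does not separate and which the residency's paper
(§3quater, Theorem II‴) separates by a LENGTH (coradical) invariant.  Three of them used the
alternating-zeta solid `E_η(2)` (volume `π²/12`) as the source of even powers of `π`; treating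
`η̃(2)` in the paper costs one extra input (the two-step structure of the dilogarithm motive at `−1`
plus Euler's `ζ(2) = π²/6`).  The present file records the INPUT-MINIMAL variants of the same three
faces, in which every even power of `π` comes from an **arctangent solid**
`A_m = {t · ∏ᵢ(1 + xᵢ²) ≤ 1} ⊂ [0,1]ᵐ⁺¹` (volume `(π/4)ᵐ`, `soloInformed_value_atanSolid`), whose
formal period is PURE of weight `2m` with no input at all (paper, Lemma R / Lemma U′):

* **L2′** (`LocRung₄`): `E_η(3)` against `A₂ ⊠ Λ₁ = E_{(1+x₀²)(1+x₁²)(1+x₂)}` (volume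
  `(π²/16) log 2`) — **`NoLocRel ↔ ζ(3)/(π² log 2) ∉ ℚ`**;
* **L3′** (`LocRung₆`): `E_η(5)` against `E_η(3) ⊠ A₂ = E_{(1+x₀x₁x₂)(1+x₃²)(1+x₄²)}` (volume
  `(3/4) ζ(3) · π²/16`) — **`NoLocRel ↔ ζ(5)/(π² ζ(3)) ∉ ℚ`**;
* **L4′** (`LocRung₇`): `E_η(3) ⊠ E_η(3)` (volume `(9/16) ζ(3)²`) against `A₆` (volume `π⁶/4096`) —
  **`NoLocRel ↔ ζ(3)²/π⁶ ∉ ℚ`**.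

The three irrationality statements are those of `SoloInformedLengthFaces` (OPEN; consequences of
the conjectured algebraic independence of `π, log 2, ζ(3), ζ(5)` [Waldschmidt 2004, §3]); under the
Kontsevich–Zagier conjecture each face is an explicit no-certificate statement between two solids
in one cube (`soloInformed_kz_lengthFacesAtan`).  The kernel content is the exact equivalence at
each rung (`soloInformed_locRung_subgraphNoLocRelation_iff`) and the volume computations.

Residency `solo-KontsevichZagierPeriods-informed` (PLAN.md, session s20).

References: M. Kontsevich, D. Zagier, *Periods* (2001), §1.2, §4.1; F. Brown, *Notes on motivic
periods*, Commun. Number Theory Phys. 11 (2017), §§2.5, 3.1 (arXiv:1512.06410); A. B. Goncharov,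
*Galois symmetries of fundamental groupoids and noncommutative geometry*, Duke Math. J. 128 (2005),
Cor. 6.2 (arXiv:math/0208144); M. Waldschmidt, *Open Diophantine problems*, Moscow Math. J. 4
(2004), §3.
-/

noncomputable section

open MeasureTheory Set Filter
open scoped Topology

namespace Summit.KontsevichZagierPeriods.KontsevichZagierPeriods.Theorems

open Literature.NumberTheory.Transcendental Literature.NumberTheory.Transcendental.KZ

/-! ### Face L2′ (`LocRung₄`): `E_η(3)` against `A₂ ⊠ Λ₁ = E_{(1+x₀²)(1+x₁²)(1+x₂)}` -/

/-- `(1 + x₀²)(1 + x₁²)(1 + x₂) ∈ ℚ[x₀, x₁, x₂]`. -/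
def soloInformedAtanTwoLogPoly : MvPolynomial (Fin 3) ℚ :=
  soloInformedBlockMul (soloInformedAtanPoly 2) (soloInformedLogPoly 1)

/-- `(1 + x₀²)(1 + x₁²)(1 + x₂) ≥ 1` on the cube. -/
theorem soloInformed_atanTwoLogPoly_ge_one :
    ∀ x ∈ KZ.cube 3, (1 : ℝ) ≤ MvPolynomial.aeval x soloInformedAtanTwoLogPoly :=
  soloInformed_blockMul_ge_one _ _ (soloInformed_atanPoly_ge_one 2) (soloInformed_logPoly_ge_one 1)

/-- **`E_{(1+x₀²)(1+x₁²)(1+x₂)} ⊂ [0,1]⁴`**, volume `(π/4)² log 2`. -/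
def soloInformedAtanTwoLogSolid : IntegralRep 4 :=
  soloInformedSubgraphRep soloInformedAtanTwoLogPoly soloInformed_atanTwoLogPoly_ge_one

/-- `vol E_{(1+x₀²)(1+x₁²)(1+x₂)} = (π/4)² · log 2`. -/
theorem soloInformed_value_atanTwoLogSolid :
    (soloInformedSubgraphRep soloInformedAtanTwoLogPoly soloInformed_atanTwoLogPoly_ge_one).value =
      (Real.pi / 4) ^ 2 * Real.log 2 :=
  (soloInformed_value_blockRep (soloInformedAtanPoly 2) (soloInformedLogPoly 1)
    (soloInformed_atanPoly_ge_one 2) (soloInformed_logPoly_ge_one 1)).trans (by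
      rw [show (soloInformedSubgraphRep (soloInformedAtanPoly 2) (soloInformed_atanPoly_ge_one 2)).value =
          (Real.pi / 4) ^ 2 from soloInformed_value_atanSolid 2,
        show (soloInformedSubgraphRep (soloInformedLogPoly 1) (soloInformed_logPoly_ge_one 1)).value =
          Real.log 2 ^ 1 from soloInformed_value_logSolid 1, pow_one])

/-- **`NoLocRel(η₃, A₂ ⊠ Λ₁)`**: no `N` and no positive `a, b` with
`⟦[π]⟧ᴺ · ⟦a·[E_η(3)] − b·[E_{(1+x₀²)(1+x₁²)(1+x₂)}]⟧ = 0` (solids in `[0,1]⁴` of volumes `(3/4) ζ(3)`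
and `(π²/16) log 2`; proved in the paper, §3quater, from fewer inputs than face L2; OPEN as a kernel
statement). -/
@[conjecture] def SoloInformedEtaThreeAtanTwoLogNoLocRelation : Prop :=
  ∀ N a b : ℕ, a ≠ 0 → b ≠ 0 →
    toFormalPeriod (of piRep) ^ N *
      toFormalPeriod (a • of (soloInformedEtaSolid 3) - b • of soloInformedAtanTwoLogSolid) ≠ 0

/-- `vol E_η(3) / vol E_{(1+x₀²)(1+x₁²)(1+x₂)} ∉ ℚ ↔ ζ(3)/(π² log 2) ∉ ℚ`. -/
theorem soloInformed_faceL2'_ratio_iff :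
    Irrational ((soloInformedSubgraphRep (soloInformedEtaPoly 3) (soloInformed_etaPoly_ge_one 3)).value /
        (soloInformedSubgraphRep soloInformedAtanTwoLogPoly soloInformed_atanTwoLogPoly_ge_one).value) ↔
      SoloInformedZetaThreeOverPiSqLogTwoIrrational := by
  rw [soloInformed_value_etaSolid_three, soloInformed_value_atanTwoLogSolid]
  have hπ : Real.pi ≠ 0 := Real.pi_pos.ne'
  have hl : Real.log 2 ≠ 0 := (Real.log_pos one_lt_two).ne'
  refine soloInformed_irrational_congr_ratMul (12 : ℚ) (by positivity) ?_
  push_cast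
  field_simp
  ring

/-- **Face L2′: `LocRung₄ → (NoLocRel(η₃, A₂ ⊠ Λ₁) ↔ ζ(3)/(π² log 2) ∉ ℚ)`.** -/
theorem soloInformed_locRung_four_faceL2'_iff (h : SoloInformedLocVolumeRung 4) :
    SoloInformedEtaThreeAtanTwoLogNoLocRelation ↔ SoloInformedZetaThreeOverPiSqLogTwoIrrational :=
  (soloInformed_locRung_subgraphNoLocRelation_iff (soloInformedEtaPoly 3) soloInformedAtanTwoLogPoly
    (soloInformed_etaPoly_ge_one 3) soloInformed_atanTwoLogPoly_ge_one h).trans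
    soloInformed_faceL2'_ratio_iff

/-- `Rung₄ → (NoLocRel(η₃, A₂ ⊠ Λ₁) ↔ ζ(3)/(π² log 2) ∉ ℚ)`. -/
theorem soloInformed_rung_four_faceL2'_iff (h : SoloInformedVolumeRung 4) :
    SoloInformedEtaThreeAtanTwoLogNoLocRelation ↔ SoloInformedZetaThreeOverPiSqLogTwoIrrational :=
  soloInformed_locRung_four_faceL2'_iff (soloInformed_locVolumeRung_of_volumeRung h)

/-- `ζ(3)/(π² log 2) ∉ ℚ → NoLocRel(η₃, A₂ ⊠ Λ₁)`, unconditionally. -/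
theorem soloInformed_faceL2'_of_irrational (hirr : SoloInformedZetaThreeOverPiSqLogTwoIrrational) :
    SoloInformedEtaThreeAtanTwoLogNoLocRelation := fun N a b ha _ =>
  soloInformed_subgraphNoLocRelation_of_irrational _ _ _ _ (soloInformed_faceL2'_ratio_iff.2 hirr) N a b ha

/-- Faces L2 and L2′ are equivalent at `LocRung₄` (both are `ζ(3)/(π² log 2) ∉ ℚ`). -/
theorem soloInformed_locRung_four_faceL2'_iff_faceL2 (h : SoloInformedLocVolumeRung 4) :
    SoloInformedEtaThreeAtanTwoLogNoLocRelation ↔ SoloInformedEtaThreeEtaTwoLogNoLocRelation :=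
  (soloInformed_locRung_four_faceL2'_iff h).trans (soloInformed_locRung_four_faceL2_iff h).symm

/-! ### Face L3′ (`LocRung₆`): `E_η(5)` against `E_η(3) ⊠ A₂ = E_{(1+x₀x₁x₂)(1+x₃²)(1+x₄²)}` -/

/-- `(1 + x₀x₁x₂)(1 + x₃²)(1 + x₄²) ∈ ℚ[x₀, …, x₄]`. -/
def soloInformedEtaThreeAtanTwoPoly : MvPolynomial (Fin 5) ℚ :=
  soloInformedBlockMul (soloInformedEtaPoly 3) (soloInformedAtanPoly 2)

/-- `(1 + x₀x₁x₂)(1 + x₃²)(1 + x₄²) ≥ 1` on the cube. -/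
theorem soloInformed_etaThreeAtanTwoPoly_ge_one :
    ∀ x ∈ KZ.cube 5, (1 : ℝ) ≤ MvPolynomial.aeval x soloInformedEtaThreeAtanTwoPoly :=
  soloInformed_blockMul_ge_one _ _ (soloInformed_etaPoly_ge_one 3) (soloInformed_atanPoly_ge_one 2)

/-- **`E_{(1+x₀x₁x₂)(1+x₃²)(1+x₄²)} ⊂ [0,1]⁶`**, volume `(3/4) ζ(3) · (π/4)²`. -/
def soloInformedEtaThreeAtanTwoSolid : IntegralRep 6 :=
  soloInformedSubgraphRep soloInformedEtaThreeAtanTwoPoly soloInformed_etaThreeAtanTwoPoly_ge_one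

/-- `vol E_{(1+x₀x₁x₂)(1+x₃²)(1+x₄²)} = (3/4) ζ(3) · (π/4)²`. -/
theorem soloInformed_value_etaThreeAtanTwoSolid :
    (soloInformedSubgraphRep soloInformedEtaThreeAtanTwoPoly soloInformed_etaThreeAtanTwoPoly_ge_one).value =
      ((3 / 4 : ℚ) : ℝ) * zetaValue 3 * (Real.pi / 4) ^ 2 :=
  (soloInformed_value_blockRep (soloInformedEtaPoly 3) (soloInformedAtanPoly 2)
    (soloInformed_etaPoly_ge_one 3) (soloInformed_atanPoly_ge_one 2)).trans (by
      rw [soloInformed_value_etaSolid_three,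
        show (soloInformedSubgraphRep (soloInformedAtanPoly 2) (soloInformed_atanPoly_ge_one 2)).value =
          (Real.pi / 4) ^ 2 from soloInformed_value_atanSolid 2])

/-- **`NoLocRel(η₅, η₃ ⊠ A₂)`**: no `N` and no positive `a, b` with
`⟦[π]⟧ᴺ · ⟦a·[E_η(5)] − b·[E_{(1+x₀x₁x₂)(1+x₃²)(1+x₄²)}]⟧ = 0` (solids in `[0,1]⁶` of volumes
`(15/16) ζ(5)` and `(3/4) ζ(3) π²/16`; proved in the paper, §3quater, from fewer inputs than face L3;
OPEN as a kernel statement). -/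
@[conjecture] def SoloInformedEtaFiveEtaThreeAtanTwoNoLocRelation : Prop :=
  ∀ N a b : ℕ, a ≠ 0 → b ≠ 0 →
    toFormalPeriod (of piRep) ^ N *
      toFormalPeriod (a • of (soloInformedEtaSolid 5) - b • of soloInformedEtaThreeAtanTwoSolid) ≠ 0

/-- `vol E_η(5) / vol E_{(1+x₀x₁x₂)(1+x₃²)(1+x₄²)} ∉ ℚ ↔ ζ(5)/(π² ζ(3)) ∉ ℚ`. -/
theorem soloInformed_faceL3'_ratio_iff :
    Irrational ((soloInformedSubgraphRep (soloInformedEtaPoly 5) (soloInformed_etaPoly_ge_one 5)).value /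
        (soloInformedSubgraphRep soloInformedEtaThreeAtanTwoPoly
          soloInformed_etaThreeAtanTwoPoly_ge_one).value) ↔
      SoloInformedZetaFiveOverPiSqZetaThreeIrrational := by
  rw [soloInformed_value_etaSolid_five, soloInformed_value_etaThreeAtanTwoSolid]
  have hπ : Real.pi ≠ 0 := Real.pi_pos.ne'
  have hz : zetaValue 3 ≠ 0 := (soloInformed_zetaValue_pos (n := 3) (by norm_num)).ne'
  refine soloInformed_irrational_congr_ratMul (20 : ℚ) (by positivity) ?_
  push_cast
  field_simp
  ring

/-- **Face L3′: `LocRung₆ → (NoLocRel(η₅, η₃ ⊠ A₂) ↔ ζ(5)/(π² ζ(3)) ∉ ℚ)`.** -/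
theorem soloInformed_locRung_six_faceL3'_iff (h : SoloInformedLocVolumeRung 6) :
    SoloInformedEtaFiveEtaThreeAtanTwoNoLocRelation ↔ SoloInformedZetaFiveOverPiSqZetaThreeIrrational :=
  (soloInformed_locRung_subgraphNoLocRelation_iff (soloInformedEtaPoly 5) soloInformedEtaThreeAtanTwoPoly
    (soloInformed_etaPoly_ge_one 5) soloInformed_etaThreeAtanTwoPoly_ge_one h).trans
    soloInformed_faceL3'_ratio_iff

/-- `Rung₆ → (NoLocRel(η₅, η₃ ⊠ A₂) ↔ ζ(5)/(π² ζ(3)) ∉ ℚ)`. -/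
theorem soloInformed_rung_six_faceL3'_iff (h : SoloInformedVolumeRung 6) :
    SoloInformedEtaFiveEtaThreeAtanTwoNoLocRelation ↔ SoloInformedZetaFiveOverPiSqZetaThreeIrrational :=
  soloInformed_locRung_six_faceL3'_iff (soloInformed_locVolumeRung_of_volumeRung h)

/-- `ζ(5)/(π² ζ(3)) ∉ ℚ → NoLocRel(η₅, η₃ ⊠ A₂)`, unconditionally. -/
theorem soloInformed_faceL3'_of_irrational (hirr : SoloInformedZetaFiveOverPiSqZetaThreeIrrational) :
    SoloInformedEtaFiveEtaThreeAtanTwoNoLocRelation := fun N a b ha _ =>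
  soloInformed_subgraphNoLocRelation_of_irrational _ _ _ _ (soloInformed_faceL3'_ratio_iff.2 hirr) N a b ha

/-- Faces L3 and L3′ are equivalent at `LocRung₆` (both are `ζ(5)/(π² ζ(3)) ∉ ℚ`). -/
theorem soloInformed_locRung_six_faceL3'_iff_faceL3 (h : SoloInformedLocVolumeRung 6) :
    SoloInformedEtaFiveEtaThreeAtanTwoNoLocRelation ↔ SoloInformedEtaFiveEtaThreeTwoNoLocRelation :=
  (soloInformed_locRung_six_faceL3'_iff h).trans (soloInformed_locRung_six_faceL3_iff h).symm

/-! ### Face L4′ (`LocRung₇`): `E_η(3) ⊠ E_η(3)` against the arctangent solid `A₆` -/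

/-- **`NoLocRel(η₃ ⊠ η₃, A₆)`**: no `N` and no positive `a, b` with
`⟦[π]⟧ᴺ · ⟦a·[E_{(1+x₀x₁x₂)(1+x₃x₄x₅)}] − b·[A₆]⟧ = 0` (solids in `[0,1]⁷` of volumes `(9/16) ζ(3)²`
and `π⁶/4096`; proved in the paper, §3quater, from the single input (Λ₃); OPEN as a kernel
statement). -/
@[conjecture] def SoloInformedEtaThreeSqAtanSixNoLocRelation : Prop :=
  ∀ N a b : ℕ, a ≠ 0 → b ≠ 0 →
    toFormalPeriod (of piRep) ^ N *
      toFormalPeriod (a • of soloInformedEtaThreeThreeSolid - b • of (soloInformedAtanSolid 6)) ≠ 0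

/-- `vol E_{η₃⊠η₃} / vol A₆ ∉ ℚ ↔ ζ(3)²/π⁶ ∉ ℚ`. -/
theorem soloInformed_faceL4'_ratio_iff :
    Irrational ((soloInformedSubgraphRep soloInformedEtaThreeThreePoly soloInformed_etaThreeThreePoly_ge_one).value /
        (soloInformedSubgraphRep (soloInformedAtanPoly 6) (soloInformed_atanPoly_ge_one 6)).value) ↔
      SoloInformedZetaThreeSqOverPiSixthIrrational := by
  rw [soloInformed_value_etaThreeThreeSolid,
    show (soloInformedSubgraphRep (soloInformedAtanPoly 6) (soloInformed_atanPoly_ge_one 6)).value =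
      (Real.pi / 4) ^ 6 from soloInformed_value_atanSolid 6]
  have hπ : Real.pi ≠ 0 := Real.pi_pos.ne'
  refine soloInformed_irrational_congr_ratMul (2304 : ℚ) (by positivity) ?_
  push_cast
  field_simp
  ring

/-- **Face L4′: `LocRung₇ → (NoLocRel(η₃ ⊠ η₃, A₆) ↔ ζ(3)²/π⁶ ∉ ℚ)`.** -/
theorem soloInformed_locRung_seven_faceL4'_iff (h : SoloInformedLocVolumeRung 7) :
    SoloInformedEtaThreeSqAtanSixNoLocRelation ↔ SoloInformedZetaThreeSqOverPiSixthIrrational :=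
  (soloInformed_locRung_subgraphNoLocRelation_iff soloInformedEtaThreeThreePoly (soloInformedAtanPoly 6)
    soloInformed_etaThreeThreePoly_ge_one (soloInformed_atanPoly_ge_one 6) h).trans
    soloInformed_faceL4'_ratio_iff

/-- `Rung₇ → (NoLocRel(η₃ ⊠ η₃, A₆) ↔ ζ(3)²/π⁶ ∉ ℚ)`. -/
theorem soloInformed_rung_seven_faceL4'_iff (h : SoloInformedVolumeRung 7) :
    SoloInformedEtaThreeSqAtanSixNoLocRelation ↔ SoloInformedZetaThreeSqOverPiSixthIrrational :=
  soloInformed_locRung_seven_faceL4'_iff (soloInformed_locVolumeRung_of_volumeRung h)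

/-- `ζ(3)²/π⁶ ∉ ℚ → NoLocRel(η₃ ⊠ η₃, A₆)`, unconditionally. -/
theorem soloInformed_faceL4'_of_irrational (hirr : SoloInformedZetaThreeSqOverPiSixthIrrational) :
    SoloInformedEtaThreeSqAtanSixNoLocRelation := fun N a b ha _ =>
  soloInformed_subgraphNoLocRelation_of_irrational _ _ _ _ (soloInformed_faceL4'_ratio_iff.2 hirr) N a b ha

/-- Faces L4 and L4′ are equivalent at `LocRung₇` (both are `ζ(3)²/π⁶ ∉ ℚ`). -/
theorem soloInformed_locRung_seven_faceL4'_iff_faceL4 (h : SoloInformedLocVolumeRung 7) :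
    SoloInformedEtaThreeSqAtanSixNoLocRelation ↔ SoloInformedEtaThreeSqEtaTwoCubeNoLocRelation :=
  (soloInformed_locRung_seven_faceL4'_iff h).trans (soloInformed_locRung_seven_faceL4_iff h).symm

/-! ### Under the conjecture -/

/-- **The three arctangent length faces of the Kontsevich–Zagier conjecture.**  Under
`KontsevichZagierPeriods` (which gives every local rung, `soloInformed_locVolumeRung_of_kzp`):
`NoLocRel(η₃, A₂ ⊠ Λ₁) ↔ ζ(3)/(π² log 2) ∉ ℚ`, `NoLocRel(η₅, η₃ ⊠ A₂) ↔ ζ(5)/(π² ζ(3)) ∉ ℚ` and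
`NoLocRel(η₃ ⊠ η₃, A₆) ↔ ζ(3)²/π⁶ ∉ ℚ`. -/
theorem soloInformed_kz_lengthFacesAtan (hKZ : KontsevichZagierPeriods) :
    (SoloInformedEtaThreeAtanTwoLogNoLocRelation ↔ SoloInformedZetaThreeOverPiSqLogTwoIrrational) ∧
    (SoloInformedEtaFiveEtaThreeAtanTwoNoLocRelation ↔ SoloInformedZetaFiveOverPiSqZetaThreeIrrational) ∧
    (SoloInformedEtaThreeSqAtanSixNoLocRelation ↔ SoloInformedZetaThreeSqOverPiSixthIrrational) :=
  ⟨soloInformed_locRung_four_faceL2'_iff (soloInformed_locVolumeRung_of_kzp hKZ 4),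
    soloInformed_locRung_six_faceL3'_iff (soloInformed_locVolumeRung_of_kzp hKZ 6),
    soloInformed_locRung_seven_faceL4'_iff (soloInformed_locVolumeRung_of_kzp hKZ 7)⟩

/-- Under `KontsevichZagierPeriods`, the paper's Theorem II‴ (the three `NoLocRel` statements) is
equivalent to the conjunction of the three OPEN irrationality statements. -/
theorem soloInformed_kz_lengthFacesAtan_irrational (hKZ : KontsevichZagierPeriods)
    (h₂ : SoloInformedEtaThreeAtanTwoLogNoLocRelation) (h₃ : SoloInformedEtaFiveEtaThreeAtanTwoNoLocRelation)
    (h₄ : SoloInformedEtaThreeSqAtanSixNoLocRelation) :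
    SoloInformedZetaThreeOverPiSqLogTwoIrrational ∧ SoloInformedZetaFiveOverPiSqZetaThreeIrrational ∧
      SoloInformedZetaThreeSqOverPiSixthIrrational :=
  let h := soloInformed_kz_lengthFacesAtan hKZ
  ⟨h.1.1 h₂, h.2.1.1 h₃, h.2.2.1 h₄⟩

end Summit.KontsevichZagierPeriods.KontsevichZagierPeriods.Theorems

end
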